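import Summits.QuantumFields.YangMills.Theorems.BalabanUVNodesK0RecordFormatNamesAx
import Literature.MathematicalPhysics.QuantumFieldTheory.Balaban1983to89.B14Eq213MaximalDomains
import Literature.MathematicalPhysics.QuantumFieldTheory.Balaban1983to89.B15Eq112TorusCover
import Literature.MathematicalPhysics.QuantumFieldTheory.Balaban1983to89.B12RegularSpaces111SpecialUnitary

/-!
# K0⁷ — THE RECORD-SIDE FORMAT NAMES, EDITION 13: THE DEFINITION VENUE OF THE RESIDUE's PIECES (port-lead OPEN POINT O-2 ∕ PTA-1 RESIDUE-MAP (R3)) —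
# window-local, `SL(2,ℂ)`-gauge-invariant INTEGER-LOCAL FORMULA OBJECTS `IntLocalFormula s`, their pieces ON PAIRS at every volume, and the three
# receipts (a) analyticity ∕ (b) (1.18) ∕ (f′) the (1.9)-pair identity — the structure the residue of 27930⁸ (`…PortS1Residue.sig27930v8_of_residue[₂]`)
# quantifies over, BY NAME, so that (R4)'s porters construct ONE object per formula (`Ψ_FE` [II] (2.13)∕Lemma 3, `Ψ_LZ` [16] (63)) instead of re-threading ∃-packages

Cell `ym-nodeO-ideate` ∕ `ym-balaban-port`, DEFINER seat `ym-nodeO-def-1` (gen 34), on port-lead LEAD NOTE N-17 O-2 (nodeO STATUS 2026-08-31T00:55:47Z) and porter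
PT-A-1 gen 2's RESIDUE-MAP-v1 (aaf4abc15176faec) §0∕§4 (3).  The SHAPES are frozen to the raw binders of `…PortS1Assembly.formatPlusG_recordJ_of_intLocalResidue[₂]`
(✓p797604∕p798027) and `…PortS1Residue.sig27930v8_of_residue[₂]` (✓p797955∕p798922): every predicate below UNFOLDS (`Iff.rfl` ∕ `rfl`, lemma file 8) to the corresponding
hypothesis there.  `--kind definition --supports stmt-QuantumFields-20541 --as helper`; count-neutral.  [I] = [Balaban1987RG1], [II] = [Balaban1988RG2Cluster],
[16] = [Balaban1985UVStability3D].

WHAT THIS FILE IS (definitions only):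
* §1 INTEGER-BOND CONFIGURATIONS AND FORMULAS: `IntBondCfg` = pairs `(𝐔, 𝐉) ∈ M₂(ℂ)²` on the integer bonds `(z, μ)` of `ℤ⁴`; `IntFormula` = `Ψ : Finset ℤ⁴ → IntBondCfg → ℂ`
  (a finite set `X̂` of INTEGER cube indices, a configuration); `intSites s X̂ = ⋃_{a ∈ X̂} cubeExt s a 0` (the integer sites of `X̂` at cube side `s`); `intShift (z, μ) = z + e_μ`;
  (LOC) `IntFormula.IsLocal s Ψ` — `Ψ X̂ f` reads `f` only at bonds with both ends in `intSites s X̂` ([I] (1.7) p.261 «depends on U_j restricted to X»);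
  `intGaugeAct û f` — the pulled-back (1.10) action `(𝐔, 𝐉) ↦ (û_x 𝐔 û_{x+μ}⁻¹, û_x 𝐉 û_x⁻¹)`; (GI) `IntFormula.IsGaugeInv Ψ` — invariance for every `SL(2,ℂ)`-valued `û`
  ((1.19) p.263 «for all Gᶜ-valued gauge transformations»).
* §2 ★ THE OBJECT `structure IntLocalFormula (s : ℕ)` = `(Ψ, isLocal, isGaugeInv)`; `IntLocalFormula.add` (the sum of two is one — print's `Ψ_LZ + Ψ_FE`, [I] p.261 L22–24).
* §3 RECORD READINGS at volume `K`: `intCubes F Mc k K X` (the `valMinAbs` representatives of the cube indices of `X ∈ 𝐃_{k+1}(T_K)`), `pullPair F K φ` (a pair on `T_K` pulled back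
  to integer bonds through the universal cover `B15Eq112TorusCover.cover`), `IntFormula.piece Ψ F Mc k K X φ := Ψ (intCubes …) (pullPair …)` (THE PIECE ON PAIRS `E(X, φ)`),
  `pairCutAt F a₀ ε₂₉ Mc k K X B` (the (f′) integrand: print's (1.9) pair `(U_{k+1}(W_B), J(U_{k+1}(W_B)))` CUT TO `X` — `1 ∕ 0` off the bonds of `X` — pulled back; rooted gauge).
* §4 RECEIPTS (Prop-valued, parameters; assert nothing) on the shifted volumes `recordK₀ F Mc k + n`: (a) `IntFormula.AnalyticOnUc Ψ F Mc k α₀ α₁`; (b) `IntFormula.Bound118OnUc Ψ F Mc k α₀ α₁ E₀ κ`;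
  (f′) `IntFormula.Represents Ψ F a₀ ε₂₉ Mc k Φf` (`∀ n, ∀ᶠ B in 𝓝 0, Φf n B = Σ_X Ψ.piece … X (pairCutAt … X B)`); the bundle `IntLocalFormula.ResidueAt` = (a) ∧ (b) ∧ (f′).
Optional finiteness (for `…PortS1LocalFormula` §6 `analyticAt_cpair_of_finiteFormula`): `IntFormula.FactorsThrough` — a receipt, NOT a structure field ([II]'s polymer sums are
finite per `X`, but the venue does not hard-wire it).

HONEST FRAMING.  Definitions only; NO piece of Bałaban's is constructed here; the residue (a)(b)(f′) of 27930⁸ is NOT proved, NOT a fact; 27930⁸-Ax OPEN (LR4 re-signature pending);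
K0⁷ `Record13SepCoPHInhabited` NOT closed; NODE O not inhabited (0∕1); COUNT 8∕28 · K 1∕4 UNMOVED; finite `𝕋⁴_{L^K}` at fixed ε — NOT continuum ∕ ℝ⁴ ∕ OS; **the Yang–Mills mass
gap (Clay) is NOT proved by any of this.**  No `sorry`, `instance`, `notation`; standard axioms.
-/

noncomputable section

open scoped BigOperators Matrix.Norms.L2Operator Topology

namespace Summit.QuantumFields.YangMills.Theorems.K0RecordFormatNames

open Literature.MathematicalPhysics.QuantumFieldTheory.Balaban1983to89
open Literature.MathematicalPhysics.QuantumFieldTheory.Balaban1983to89.Node00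
open Literature.MathematicalPhysics.QuantumFieldTheory.Balaban1983to89.T4Continuum (T4Family)
open Literature.MathematicalPhysics.QuantumFieldTheory.Balaban1983to89.B15Eq112TorusCover (cover)
open Literature.MathematicalPhysics.QuantumFieldTheory.Balaban1983to89.B14.Eq213MaximalDomains (cubeExt)
open _root_.Filter

/-! ## §1  Integer-bond configurations, integer formulas, window-locality, the pulled-back (1.10) action -/

/-- **Integer-bond configurations**: pairs `(𝐔, 𝐉) ∈ M₂(ℂ) × M₂(ℂ)` on the integer bonds `(z, μ)`, `z ∈ ℤ⁴`, `μ` a direction (the pulled-back (1.9) variables).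
[cite: Balaban1987RG1, (1.9)–(1.10) pp.261–262] -/
abbrev IntBondCfg : Type := ((Fin 4 → ℤ) × Fin 4) → MatA 2 × MatA 2

/-- **Integer formulas**: `Ψ X̂ f ∈ ℂ` for a finite set `X̂ ⊂ ℤ⁴` of integer CUBE INDICES and an integer-bond configuration `f` — ONE formula for every volume
(the localized pieces of [I] §3–§5 ∕ [II] ∕ [16] (63) are finite sums over walks ∕ polymers inside `X` of products of bond variables). [cite: Balaban1987RG1, (1.7) p.261, (1.21) p.264] -/
abbrev IntFormula : Type := Finset (Fin 4 → ℤ) → IntBondCfg → ℂ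

/-- The INTEGER SITES of a cube-index set `X̂` at cube side `s` (fine sites per cube edge): `⋃_{a ∈ X̂} [s·a, s·a + s)⁴` (`cubeExt s a 0`).
[cite: Balaban1987RG1, p.257 (the cubes π_j)] -/
def intSites (s : ℕ) (Xh : Finset (Fin 4 → ℤ)) : Set (Fin 4 → ℤ) := ⋃ a ∈ Xh, cubeExt s a 0

/-- The target site `z + e_μ` of the integer bond `(z, μ)`. [cite: Balaban1987RG1, p.257 (bookkeeping)] -/
def intShift (zμ : (Fin 4 → ℤ) × Fin 4) : Fin 4 → ℤ := Function.update zμ.1 zμ.2 (zμ.1 zμ.2 + 1)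

/-- **(LOC) WINDOW-LOCALITY at cube side `s`**: `Ψ X̂ f` depends on `f` only at the integer bonds with BOTH ends in the integer sites of `X̂` — [I] (1.7) «the term
corresponding to a domain X depends on U_j restricted to X».  (The binder shape of `…PortS1LocalFormula.local17_cpair_of_intLocalFormula`'s `hΨ`, verbatim.)
[cite: Balaban1987RG1, (1.7) p.261] -/
def IntFormula.IsLocal (s : ℕ) (Ψ : IntFormula) : Prop :=
  ∀ (Xh : Finset (Fin 4 → ℤ)) (f f' : IntBondCfg),
    (∀ zμ : (Fin 4 → ℤ) × Fin 4, zμ.1 ∈ (⋃ a ∈ Xh, cubeExt s a 0) →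
      Function.update zμ.1 zμ.2 (zμ.1 zμ.2 + 1) ∈ (⋃ a ∈ Xh, cubeExt s a 0) → f zμ = f' zμ) → Ψ Xh f = Ψ Xh f'

/-- **The pulled-back (1.10) action** of a units-valued integer gauge function `û : ℤ⁴ → M₂(ℂ)ˣ` on integer-bond pairs:
`(𝐔, 𝐉)(z, μ) ↦ (û_z 𝐔 û_{z+e_μ}⁻¹, û_z 𝐉 û_z⁻¹)`. [cite: Balaban1987RG1, (1.10) p.262] -/
def intGaugeAct (û : (Fin 4 → ℤ) → (MatA 2)ˣ) (f : IntBondCfg) : IntBondCfg :=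
  fun zμ => ((û zμ.1 : MatA 2) * (f zμ).1 * ((û (Function.update zμ.1 zμ.2 (zμ.1 zμ.2 + 1)))⁻¹ : (MatA 2)ˣ),
    (û zμ.1 : MatA 2) * (f zμ).2 * ((û zμ.1)⁻¹ : (MatA 2)ˣ))

/-- **(GI) `SL(2,ℂ)`-GAUGE INVARIANCE**: `Ψ X̂ (f^û) = Ψ X̂ f` for every `û` with values in `Gᶜ = SL(2,ℂ)` (`(suModel 2).Gc`) — [I] (1.19) «for all Gᶜ-valued gauge
transformations u».  (The binder shape of `…PortS1Assembly`'s `hΨG`, verbatim.) [cite: Balaban1987RG1, (1.19) p.263, (1.10) p.262] -/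
def IntFormula.IsGaugeInv (Ψ : IntFormula) : Prop :=
  ∀ (Xh : Finset (Fin 4 → ℤ)) (û : (Fin 4 → ℤ) → (MatA 2)ˣ), (∀ z, û z ∈ (B12RegularSpaces111SpecialUnitary.suModel 2).Gc) →
    ∀ f : IntBondCfg,
      Ψ Xh (fun zμ => ((û zμ.1 : MatA 2) * (f zμ).1 * ((û (Function.update zμ.1 zμ.2 (zμ.1 zμ.2 + 1)))⁻¹ : (MatA 2)ˣ),
        (û zμ.1 : MatA 2) * (f zμ).2 * ((û zμ.1)⁻¹ : (MatA 2)ˣ))) = Ψ Xh f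

/-- **Optional FINITENESS receipt**: `Ψ X̂` factors through the restriction to a FINITE set `S X̂` of integer bonds (what `…PortS1LocalFormula` §6
`analyticAt_cpair_of_finiteFormula` consumes; [II]'s polymer sums inside `X` are finite). Not a structure field. [cite: Balaban1988RG2Cluster, (2.13) p.14; Balaban1987RG1, (1.7) p.261] -/
def IntFormula.FactorsThrough (Ψ : IntFormula) (S : Finset (Fin 4 → ℤ) → Finset ((Fin 4 → ℤ) × Fin 4)) : Prop :=
  ∀ (Xh : Finset (Fin 4 → ℤ)) (f f' : IntBondCfg), (∀ zμ ∈ S Xh, f zμ = f' zμ) → Ψ Xh f = Ψ Xh f'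

/-! ## §2  ★ THE OBJECT: window-local `SL(2,ℂ)`-gauge-invariant integer-local formulas at cube side `s`; sums -/

/-- **★ THE OBJECT `IntLocalFormula s`** — a window-local (LOC), `SL(2,ℂ)`-gauge-invariant (GI) integer-local formula at cube side `s` (at the record
`s = L^{k+1}·Mc`): the structure the residue of 27930⁸ quantifies over.  (R4)'s porters construct `Ψ_FE` ([II] (2.13)∕Lemma 3) and `Ψ_LZ` ([16] (63)) as terms of
this type; rows (c)(d)(e) of the (S1) mould then hold BY CONSTRUCTION (`…PortS1LocalFormula` §4–§5). [cite: Balaban1987RG1, (1.7) p.261, (1.19) p.263, (1.21) p.264] -/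
structure IntLocalFormula (s : ℕ) where
  /-- the formula `Ψ X̂ f` -/
  Ψ : IntFormula
  /-- (LOC) window-locality at cube side `s` -/
  isLocal : Ψ.IsLocal s
  /-- (GI) invariance under the pulled-back (1.10) action of `SL(2,ℂ)`-valued `û` -/
  isGaugeInv : Ψ.IsGaugeInv

/-- **The SUM of two objects is one** (`Ψ_LZ + Ψ_FE`: print's two halves of (1.18), [I] p.261 L22–24 ∕ [II] p.21; locality and invariance add).
[cite: Balaban1987RG1, (1.3) p.260, p.261 L22–24] -/
def IntLocalFormula.add {s : ℕ} (A B : IntLocalFormula s) : IntLocalFormula s where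
  Ψ := fun Xh f => A.Ψ Xh f + B.Ψ Xh f
  isLocal := fun Xh f f' h => by
    show A.Ψ Xh f + B.Ψ Xh f = A.Ψ Xh f' + B.Ψ Xh f'
    rw [A.isLocal Xh f f' h, B.isLocal Xh f f' h]
  isGaugeInv := fun Xh û hû f => by
    show A.Ψ Xh _ + B.Ψ Xh _ = A.Ψ Xh f + B.Ψ Xh f
    rw [A.isGaugeInv Xh û hû f, B.isGaugeInv Xh û hû f]

/-! ## §3  RECORD READINGS at volume `K`: integer cube set, pull-back of pairs, the piece ON PAIRS, the (f′) integrand -/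

variable (F : T4Family)

/-- The INTEGER CUBE-INDEX SET of a domain `X ∈ 𝐃_{k+1}(T_K)`: the `valMinAbs` (centred) representatives of its cube indices. [cite: Balaban1987RG1, p.257 (class 𝐃_j; bookkeeping)] -/
def intCubes (Mc k K : ℕ) (X : (recordDomSys F Mc k K).Dom) : Finset (Fin 4 → ℤ) :=
  (X.1 : Finset _).image (fun c (i : Fin 4) => (c i).valMinAbs)

/-- **Pull-back of a configuration pair on `T_K` to integer bonds** through the universal cover `cover : ℤ⁴ → T_K`. [cite: Balaban1987RG1, (1.9) p.261, (1.21) p.264 (bookkeeping)] -/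
def pullPair (K : ℕ) (φ : Sect2.CPair (F.P K) (MatA 2)) : IntBondCfg :=
  fun zμ => (φ.1 ⟨cover (F.P K) zμ.1, zμ.2⟩, φ.2 ⟨cover (F.P K) zμ.1, zμ.2⟩)

/-- **THE PIECE ON PAIRS `E(X, φ)` of an integer formula at volume `K`**: `Ψ (X̂_K(X)) (φ ∘ cover)` — the `EpK X φ` of `…PortS1LocalFormula` §4, as a NAME.
[cite: Balaban1987RG1, (1.7) p.261, (1.21) p.264] -/
def IntFormula.piece (Ψ : IntFormula) (Mc k K : ℕ) (X : (recordDomSys F Mc k K).Dom) (φ : Sect2.CPair (F.P K) (MatA 2)) : ℂ :=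
  Ψ (intCubes F Mc k K X) (pullPair F K φ)

open scoped Classical in
/-- **The (f′) integrand**: print's (1.9) pair `(U_{k+1}(W_B), J(U_{k+1}(W_B)))` of the charted configuration — background field in the ROOTED gauge `recordBgField`,
current `recordCurrent` — CUT TO `X` (`1 ∕ 0` off the bonds of `X`) and pulled back to integer bonds; `θ := thetaFill F a₀ ε₂₉`.  (The argument of `Ψ` in the residue's
`hR`, verbatim.) [cite: Balaban1987RG1, (1.8)–(1.9) p.261, (1.7) p.261] -/
def pairCutAt (a₀ ε₂₉ : ℝ) (Mc k K : ℕ) (X : (recordDomSys F Mc k K).Dom) (B : recordW F a₀ ε₂₉ k K) : IntBondCfg :=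
  letI θ := thetaFill F a₀ ε₂₉
  letI := θ.instVβ₁; letI := θ.instVβ₂; letI := θ.instιβ
  fun zμ =>
    ((if (⟨cover (F.P K) zμ.1, zμ.2⟩ : PBond (F.P K) 0) ∈ domBonds F Mc k K X then
        ((recordBgField F θ k K B ⟨cover (F.P K) zμ.1, zμ.2⟩ : SU 2) : MatA 2) else 1),
     (if (⟨cover (F.P K) zμ.1, zμ.2⟩ : PBond (F.P K) 0) ∈ domBonds F Mc k K X then
        recordCurrent F θ k K B ⟨cover (F.P K) zμ.1, zμ.2⟩ else 0))

/-! ## §4  RECEIPTS on the shifted volumes `recordK₀ F Mc k + n` (Prop-valued, parameters; assert nothing) -/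

/-- **(a) ANALYTICITY on the record spaces**: every pull-back piece is analytic at every pair whose coordinates lie in `recordUc … α₀ α₁ (K₀ + n) X`
(the residue's `hA`, verbatim). [cite: Balaban1987RG1, (1.11)–(1.16) pp.262–263, (1.18) p.263] -/
def IntFormula.AnalyticOnUc (Ψ : IntFormula) (Mc k : ℕ) (α₀ α₁ : ℝ) : Prop :=
  ∀ n (X : (recordDomSys F Mc k (recordK₀ F Mc k + n)).Dom) (φ : Sect2.CPair (F.P (recordK₀ F Mc k + n)) (MatA 2)),
    encodeCfg F (recordK₀ F Mc k + n) φ ∈ recordUc F Mc k α₀ α₁ (recordK₀ F Mc k + n) X →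
      AnalyticAt ℂ (fun ψ : Sect2.CPair (F.P (recordK₀ F Mc k + n)) (MatA 2) =>
        Ψ ((X.1 : Finset _).image (fun c (i : Fin 4) => (c i).valMinAbs))
          (fun zμ => (ψ.1 ⟨cover (F.P (recordK₀ F Mc k + n)) zμ.1, zμ.2⟩, ψ.2 ⟨cover (F.P (recordK₀ F Mc k + n)) zμ.1, zμ.2⟩))) φ

/-- **(b) THE (1.18) BOUND on the record spaces** with constants `E₀, κ` (the residue's `hB`, verbatim). [cite: Balaban1987RG1, (1.18) p.263] -/
def IntFormula.Bound118OnUc (Ψ : IntFormula) (Mc k : ℕ) (α₀ α₁ E₀ κ : ℝ) : Prop :=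
  ∀ n (X : (recordDomSys F Mc k (recordK₀ F Mc k + n)).Dom) (φ : Sect2.CPair (F.P (recordK₀ F Mc k + n)) (MatA 2)),
    encodeCfg F (recordK₀ F Mc k + n) φ ∈ recordUc F Mc k α₀ α₁ (recordK₀ F Mc k + n) X →
      ‖Ψ ((X.1 : Finset _).image (fun c (i : Fin 4) => (c i).valMinAbs))
          (fun zμ => (φ.1 ⟨cover (F.P (recordK₀ F Mc k + n)) zμ.1, zμ.2⟩, φ.2 ⟨cover (F.P (recordK₀ F Mc k + n)) zμ.1, zμ.2⟩))‖ ≤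
        E₀ * Real.exp (-κ * (recordDomSys F Mc k (recordK₀ F Mc k + n)).dj X)

open scoped Classical in
/-- **(f′) THE (1.9)-PAIR IDENTITY near `B = 0`** for a functional family `Φf n` on `W_{K₀+n}`: `Φf n B = Σ_X Ψ(X̂)((U_{k+1}(W_B), J(U_{k+1}(W_B)))|_X ∘ cover)` eventually
at `0` (the residue's `hR`, verbatim; at the record `Φf n := recordΦfAx F a₀ ε₂₉ k (prefixOf g k) (recordK₀ F Mc k + n)`). [cite: Balaban1987RG1, (1.6)–(1.9) p.261] -/
def IntFormula.Represents (Ψ : IntFormula) (a₀ ε₂₉ : ℝ) (Mc k : ℕ) (Φf : (n : ℕ) → recordW F a₀ ε₂₉ k (recordK₀ F Mc k + n) → ℂ) : Prop :=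
  ∀ n, letI θ := thetaFill F a₀ ε₂₉; letI := θ.instVβ₁; letI := θ.instVβ₂; letI := θ.instιβ
    ∀ᶠ B in 𝓝 (0 : recordW F a₀ ε₂₉ k (recordK₀ F Mc k + n)),
      Φf n B = ∑ X : (recordDomSys F Mc k (recordK₀ F Mc k + n)).Dom,
        Ψ ((X.1 : Finset _).image (fun c (i : Fin 4) => (c i).valMinAbs))
          (fun zμ =>
            ((if (⟨cover (F.P (recordK₀ F Mc k + n)) zμ.1, zμ.2⟩ : PBond (F.P (recordK₀ F Mc k + n)) 0) ∈
                  domBonds F Mc k (recordK₀ F Mc k + n) X then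
                ((recordBgField F θ k (recordK₀ F Mc k + n) B ⟨cover (F.P (recordK₀ F Mc k + n)) zμ.1, zμ.2⟩ : SU 2) : MatA 2) else 1),
             (if (⟨cover (F.P (recordK₀ F Mc k + n)) zμ.1, zμ.2⟩ : PBond (F.P (recordK₀ F Mc k + n)) 0) ∈
                  domBonds F Mc k (recordK₀ F Mc k + n) X then
                recordCurrent F θ k (recordK₀ F Mc k + n) B ⟨cover (F.P (recordK₀ F Mc k + n)) zμ.1, zμ.2⟩ else 0)))

/-- **THE RESIDUE AT ONE OBJECT**: (a) ∧ (b) ∧ (f′) for an `IntLocalFormula (L^{k+1}·Mc)` — what a (R4) porter proves about its ONE constructed object to feed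
`…PortS1Residue.sig27930v8_of_residue` (lemma file 8 `residue_of_intLocalFormula`). [cite: Balaban1987RG1, (1.7) p.261, (1.18)–(1.19) p.263, (1.6)–(1.9) p.261] -/
def IntLocalFormula.ResidueAt (Mc k : ℕ) (Ψ : IntLocalFormula (F.L ^ (k + 1) * Mc)) (a₀ ε₂₉ α₀ α₁ E₀ κ : ℝ)
    (Φf : (n : ℕ) → recordW F a₀ ε₂₉ k (recordK₀ F Mc k + n) → ℂ) : Prop :=
  Ψ.Ψ.AnalyticOnUc F Mc k α₀ α₁ ∧ Ψ.Ψ.Bound118OnUc F Mc k α₀ α₁ E₀ κ ∧ Ψ.Ψ.Represents F a₀ ε₂₉ Mc k Φf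

end Summit.QuantumFields.YangMills.Theorems.K0RecordFormatNames

end
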